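import Summits.Ventures.HodgeRepro.Tier3WedgeChain
import Summits.Ventures.HodgeRepro.Tier3OrbitPullback

/-!
# The eigen-coordinate dictionary: from the `F`-rational wedge basis of `H^{2p}(B_red) ⊗ F` to night-1's
coordinate model `ℂ^{J × Gal}` — LEMMA-R-RESIDUE.md v9 §11's «one line that remains», as kernel theorems

Blind re-derivation cell `pub-hodge-repro`, seat `t3-p4` (Tier 3, T3.5 for T3.4).  Target tree path
`lean/Summits/Ventures/HodgeRepro/Tier3EigenDictionary.lean`; imports the cell's `Tier3WedgeChain` (hence
`Tier3EigenBasis`, `Tier3WedgeBaseChange`, `Tier3OrbitRational`, …) and `Tier3OrbitPullback` (hence night-1's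
`Night1ReducedPullback`: `torusOn`, `coordVecOn`, `coordWedgeOn`).  The end-to-end composition with night-1's
pull-back is `Tier3LemmaRNonvanishing.lean`.

WHAT THIS FILE STATES.  LEMMA-R-RESIDUE.md v9 §11 names ONE line of §5 that was «stated, not a theorem of any
file»: the rational class `η` of the abstract rows lives in `K ⊗[F₀] ⋀^n V` with coefficients `c_U ∈ F` on the
`F`-rational wedge basis `E_U`, while night-1's rows take a class `Σ_U c_U e_U` with coefficients in `ℂ` on the
coordinate wedges of the eigen-coordinates `ℂ^{J × G}`; «under `H¹ ⊗ ℂ = (H¹ ⊗ F) ⊗_F ℂ` with `e_{(j,x)} ⊗ 1`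
spanning the `(j, x)`-eigenline the two bases of wedges agree up to units, so `c_U ≠ 0` transfers».  This file
makes that dictionary a theorem, with the ONLY hypothesis being what «eigen-coordinates» means:

* `lTensor_diag_eigenVec`, `exists_equivariant_eigenbasis_diag` — the eigenbasis `e (j, x)` of `Tier3EigenBasis`
  is an eigenbasis for the whole CM algebra `K^J` (diagonal action `A b (ω j) = b j • ω j` on the generators):
  `(1 ⊗ A b) e (j, x) = x (b j) • e (j, x)`.
* `eq_smul_coordVecOn_of_forall_torusOn` — on the model, a joint eigenvector of the torus of characters of `K^J`
  with eigen-character `(j₀, x₀)` is a multiple of the coordinate vector `e_{(j₀, x₀)}`.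
* `exists_unit_dictionary` — THE DICTIONARY ON `H¹`: for every identification
  `Ψ : ℂ ⊗[K] (K ⊗[F₀] V) ≃ ℂ^{J × Gal(K/F₀)}` that intertwines the action of `K^J` with its character torus
  (`torusOn (p ↦ p.2 (b p.1))`), `Ψ (1 ⊗ e (j, x)) = u • e_{(j, x)}` with `u ≠ 0`; `exists_eigenCoordinates` —
  such identifications exist (so the hypothesis is not vacuous).
* `map_ιMulti_tmul_eq_prod_smul_coordWedgeOn`, `map_baseChange_tmul_eq_sum_smul_coordWedgeOn` — THE DICTIONARY
  ON `H^n = ⋀^n H¹`: through the base change `K → ℂ` of the wedge space (`Φ₂`, the `(K, ℂ)`-instance of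
  `Tier3WedgeBaseChange`) and `⋀^n Ψ`, the class `1 ⊗ z` of `z = Σ_s c_s E_s` becomes `Σ_s (c_s · ∏_{p ∈ s} u_p) • e_s`
  on the coordinate wedges — the coefficients transfer up to the units `∏ u`, so «`c_U ≠ 0` for every `U` of the
  orbit» transfers verbatim.

HONESTY.  Linear algebra on Mathlib over the cell's own Tier-3 and night-1 modules; no definition is introduced;
nothing geometric is built — that `Ψ` is the identification of `H¹(B_red) ⊗ ℂ` with eigen-coordinates stays on
paper exactly as LEMMA-R-RESIDUE.md §7 lists the dictionary.  HC_CM is NOT proved by anyone in this repository.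
-/

set_option autoImplicit false

open TensorProduct Finset
open scoped Pointwise

namespace HodgeRepro.Tier3

open HodgeRepro.RouteC HodgeRepro.CMHodgeOn

variable {F₀ K : Type*} [Field F₀] [Field K] [Algebra F₀ K]
variable {V : Type*} [AddCommGroup V] [Module K V] [Module F₀ V] [IsScalarTower F₀ K V]
variable {J : Type*} [Fintype J]

/-! ### §1 The eigenbasis is an eigenbasis for the whole CM algebra `K^J` -/

section DiagEigen

variable {ι : Type*} [Fintype ι] [DecidableEq ι]
variable [FiniteDimensional F₀ K] [Algebra.IsSeparable F₀ K]

omit [Fintype J] in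
/-- The explicit eigenvector `Σ_l x(k^*_l) ⊗ (k_l • ω_j)` of `Tier3EigenBasis` is an eigenvector of the whole
CM algebra `K^J`: for any family `A : (J → K) → (V →ₗ[K] V)` acting on the basis `ω` by `A b (ω j) = b j • ω j`
(the diagonal action of `F^J` on `H¹(∏_j A_j) = ⊕_j H¹(A_j)`), `(1 ⊗ A b)` acts on it by the scalar `x (b j)`. -/
theorem lTensor_diag_eigenVec (k : Module.Basis ι F₀ K) (ω : Module.Basis J K V)
    (A : (J → K) → V →ₗ[K] V) (hA : ∀ (b : J → K) (j : J), A b (ω j) = b j • ω j)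
    (x : K ≃ₐ[F₀] K) (j : J) (b : J → K) :
    LinearMap.lTensor K ((A b).restrictScalars F₀) (∑ l, x (k.traceDual l) ⊗ₜ[F₀] (k l • ω j)) =
      x (b j) • ∑ l, x (k.traceDual l) ⊗ₜ[F₀] (k l • ω j) := by
  have hAl : ∀ l, A b (k l • ω j) = (LinearMap.lsmul K V (b j)) (k l • ω j) := by
    intro l
    rw [LinearMap.map_smul, hA, LinearMap.lsmul_apply, smul_comm]
  have h := lTensor_lsmul_eigenVec k ω x j (b j)
  simp only [map_sum, LinearMap.lTensor_tmul, LinearMap.restrictScalars_apply] at h ⊢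
  simpa only [hAl] using h

/-- **The Galois-equivariant eigenbasis, with the eigen-equation for the whole CM algebra `K^J`**: the basis `e` of
`Tier3EigenBasis.exists_equivariant_eigenbasis` (`(σ ⊗ 1) e (j, x) = e (j, σ * x)`, `(1 ⊗ b) e (j, x) = x(b) • e (j, x)`)
also satisfies `(1 ⊗ A b) e (j, x) = x (b j) • e (j, x)` for every `b : J → K`, where `A b` is the diagonal action
of `b` on the basis `ω` — `e (j, x)` spans the `(j, x)`-eigenline of `Hom(F^J, ℂ) = J × Gal(K/F₀)`. -/
theorem exists_equivariant_eigenbasis_diag [IsGalois F₀ K] (ω : Module.Basis J K V)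
    (A : (J → K) → V →ₗ[K] V) (hA : ∀ (b : J → K) (j : J), A b (ω j) = b j • ω j) :
    ∃ e : Module.Basis (J × (K ≃ₐ[F₀] K)) K (K ⊗[F₀] V),
      (∀ (σ x : K ≃ₐ[F₀] K) (j : J), LinearMap.rTensor V σ.toLinearMap (e (j, x)) = e (j, σ * x)) ∧
      (∀ (x : K ≃ₐ[F₀] K) (j : J) (b : K),
        LinearMap.lTensor K ((LinearMap.lsmul K V b).restrictScalars F₀) (e (j, x)) = x b • e (j, x)) ∧
      (∀ (x : K ≃ₐ[F₀] K) (j : J) (b : J → K),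
        LinearMap.lTensor K ((A b).restrictScalars F₀) (e (j, x)) = x (b j) • e (j, x)) := by
  classical
  let k := Module.finBasis F₀ K
  haveI : FiniteDimensional K (K ⊗[F₀] V) :=
    Module.Finite.of_basis (Algebra.TensorProduct.basis K (k.smulTower ω) : Module.Basis (_ × J) K (K ⊗[F₀] V))
  refine ⟨basisOfLinearIndependentOfCardEqFinrank' _ (linearIndependent_eigenVec k ω)
    (card_prod_algEquiv_eq_finrank k ω), ?_, ?_, ?_⟩
  · intro σ x j
    simp only [coe_basisOfLinearIndependentOfCardEqFinrank']
    exact rTensor_eigenVec k ω σ x j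
  · intro x j b
    simp only [coe_basisOfLinearIndependentOfCardEqFinrank']
    exact lTensor_lsmul_eigenVec k ω x j b
  · intro x j b
    simp only [coe_basisOfLinearIndependentOfCardEqFinrank']
    exact lTensor_diag_eigenVec k ω A hA x j b

end DiagEigen

/-! ### §2 Joint eigenvectors of the character torus on the coordinate model are coordinate vectors -/

section Model

variable [Algebra K ℂ] [DecidableEq J] [DecidableEq (K ≃ₐ[F₀] K)]

omit [Fintype J] in
/-- **A joint eigenvector of the character torus is a coordinate vector.**  On the coordinate model
`ℂ^{J × Gal(K/F₀)}`, if `v` is an eigenvector of `torusOn (p ↦ p.2 (b p.1))` with eigenvalue `x₀ (b j₀)` for EVERY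
`b : J → K` (the torus of the characters of `K^J`), then `v` is a multiple of the coordinate vector `e_{(j₀, x₀)}`:
the `(j, x)`-coordinate of `v` vanishes for `(j, x) ≠ (j₀, x₀)` (take `b = 1_{j₀}` if `j ≠ j₀`, and a `b₀` with
`x b₀ ≠ x₀ b₀` if `x ≠ x₀`). -/
theorem eq_smul_coordVecOn_of_forall_torusOn (v : J × (K ≃ₐ[F₀] K) → ℂ) (j₀ : J) (x₀ : K ≃ₐ[F₀] K)
    (hv : ∀ b : J → K,
      torusOn (fun p : J × (K ≃ₐ[F₀] K) => algebraMap K ℂ (p.2 (b p.1))) v =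
        algebraMap K ℂ (x₀ (b j₀)) • v) :
    v = v (j₀, x₀) • coordVecOn (j₀, x₀) := by
  funext p
  obtain ⟨j, x⟩ := p
  have key : ∀ b : J → K,
      algebraMap K ℂ (x (b j)) * v (j, x) = algebraMap K ℂ (x₀ (b j₀)) * v (j, x) := by
    intro b
    have := congrFun (hv b) (j, x)
    simpa only [torusOn, LinearMap.coe_mk, AddHom.coe_mk, Pi.smul_apply, smul_eq_mul] using this
  rw [Pi.smul_apply, coordVecOn_apply, smul_eq_mul]
  by_cases hp : (j, x) = (j₀, x₀)
  · rw [if_pos hp, mul_one, hp]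
  · rw [if_neg hp, mul_zero]
    -- from `a * v = a' * v` with `a ≠ a'` conclude `v = 0`
    have hcancel : ∀ {a a' : ℂ}, a ≠ a' → a * v (j, x) = a' * v (j, x) → v (j, x) = 0 := by
      intro a a' hne h
      have h' : (a - a') * v (j, x) = 0 := by rw [sub_mul, h, sub_self]
      rcases mul_eq_zero.mp h' with h0 | h0
      · exact absurd (sub_eq_zero.mp h0) hne
      · exact h0
    by_cases hj : j = j₀
    · subst hj
      have hx : x ≠ x₀ := fun h => hp (by rw [h])
      obtain ⟨b₀, hb₀⟩ : ∃ b₀ : K, x b₀ ≠ x₀ b₀ :=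
        not_forall.mp fun h => hx (AlgEquiv.ext h)
      refine hcancel ?_ (key fun _ => b₀)
      intro h
      exact hb₀ ((algebraMap K ℂ).injective h)
    · refine hcancel ?_ (key (Pi.single j₀ 1))
      rw [Pi.single_eq_of_ne hj, Pi.single_eq_same, map_zero, map_one, map_zero, map_one]
      exact zero_ne_one

omit [Fintype J] in
/-- **The dictionary on `H¹`**: for an identification `Ψ : ℂ ⊗[K] (K ⊗[F₀] V) ≃ ℂ^{J × Gal(K/F₀)}` that
intertwines the action of the CM algebra `K^J` (base-changed to `ℂ`) with the torus of its characters on the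
coordinate model — the defining property of «eigen-coordinates» — every eigenvector `e (j, x)` of `K^J` with
eigen-character `(j, x)` is carried to a NON-ZERO multiple of the coordinate vector `e_{(j, x)}`. -/
theorem exists_unit_dictionary (A : (J → K) → V →ₗ[K] V)
    (e : Module.Basis (J × (K ≃ₐ[F₀] K)) K (K ⊗[F₀] V))
    (he : ∀ (x : K ≃ₐ[F₀] K) (j : J) (b : J → K),
      LinearMap.lTensor K ((A b).restrictScalars F₀) (e (j, x)) = x (b j) • e (j, x))
    (Ψ : ℂ ⊗[K] (K ⊗[F₀] V) ≃ₗ[ℂ] (J × (K ≃ₐ[F₀] K) → ℂ))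
    (hΨ : ∀ (b : J → K) (z : ℂ ⊗[K] (K ⊗[F₀] V)),
      Ψ (LinearMap.baseChange ℂ (LinearMap.baseChange K ((A b).restrictScalars F₀)) z) =
        torusOn (fun p : J × (K ≃ₐ[F₀] K) => algebraMap K ℂ (p.2 (b p.1))) (Ψ z))
    (j : J) (x : K ≃ₐ[F₀] K) :
    ∃ u : ℂ, u ≠ 0 ∧ Ψ ((1 : ℂ) ⊗ₜ[K] e (j, x)) = u • coordVecOn (j, x) := by
  have hvec : Ψ ((1 : ℂ) ⊗ₜ[K] e (j, x)) =
      Ψ ((1 : ℂ) ⊗ₜ[K] e (j, x)) (j, x) • coordVecOn (j, x) := by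
    apply eq_smul_coordVecOn_of_forall_torusOn
    intro b
    rw [← hΨ, LinearMap.baseChange_tmul, LinearMap.baseChange_eq_ltensor, he, TensorProduct.tmul_smul,
      ← algebraMap_smul ℂ (x (b j)), LinearEquiv.map_smul]
  refine ⟨Ψ ((1 : ℂ) ⊗ₜ[K] e (j, x)) (j, x), ?_, hvec⟩
  intro h0
  rw [h0, zero_smul] at hvec
  have h1 : (1 : ℂ) ⊗ₜ[K] e (j, x) = 0 := by
    apply Ψ.injective
    rw [hvec, map_zero]
  have h2 : (e.baseChange ℂ) (j, x) = 0 := by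
    rw [Module.Basis.baseChange_apply]
    exact h1
  exact (e.baseChange ℂ).ne_zero (j, x) h2

/-- **Eigen-coordinate identifications exist** (the hypothesis of `exists_unit_dictionary` is not vacuous): sending
the base-changed eigenbasis `1 ⊗ e p` to the coordinate vectors `e_p` gives an isomorphism
`ℂ ⊗[K] (K ⊗[F₀] V) ≃ ℂ^{J × Gal(K/F₀)}` that intertwines the `K^J`-action with its character torus. -/
theorem exists_eigenCoordinates [FiniteDimensional F₀ K] (A : (J → K) → V →ₗ[K] V)
    (e : Module.Basis (J × (K ≃ₐ[F₀] K)) K (K ⊗[F₀] V))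
    (he : ∀ (x : K ≃ₐ[F₀] K) (j : J) (b : J → K),
      LinearMap.lTensor K ((A b).restrictScalars F₀) (e (j, x)) = x (b j) • e (j, x)) :
    ∃ Ψ : ℂ ⊗[K] (K ⊗[F₀] V) ≃ₗ[ℂ] (J × (K ≃ₐ[F₀] K) → ℂ),
      (∀ (b : J → K) (z : ℂ ⊗[K] (K ⊗[F₀] V)),
        Ψ (LinearMap.baseChange ℂ (LinearMap.baseChange K ((A b).restrictScalars F₀)) z) =
          torusOn (fun p : J × (K ≃ₐ[F₀] K) => algebraMap K ℂ (p.2 (b p.1))) (Ψ z)) ∧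
      ∀ p, Ψ ((1 : ℂ) ⊗ₜ[K] e p) = coordVecOn p := by
  let Ψ : ℂ ⊗[K] (K ⊗[F₀] V) ≃ₗ[ℂ] (J × (K ≃ₐ[F₀] K) → ℂ) :=
    (e.baseChange ℂ).equiv (Pi.basisFun ℂ (J × (K ≃ₐ[F₀] K))) (Equiv.refl _)
  have hΨe : ∀ p, Ψ ((1 : ℂ) ⊗ₜ[K] e p) = coordVecOn p := by
    intro p
    rw [← Module.Basis.baseChange_apply]
    show (e.baseChange ℂ).equiv (Pi.basisFun ℂ _) (Equiv.refl _) ((e.baseChange ℂ) p) = _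
    rw [Module.Basis.equiv_apply, Pi.basisFun_apply]
    rfl
  refine ⟨Ψ, fun b z => ?_, hΨe⟩
  have hext : (Ψ : ℂ ⊗[K] (K ⊗[F₀] V) →ₗ[ℂ] (J × (K ≃ₐ[F₀] K) → ℂ)) ∘ₗ
        LinearMap.baseChange ℂ (LinearMap.baseChange K ((A b).restrictScalars F₀)) =
      torusOn (fun p : J × (K ≃ₐ[F₀] K) => algebraMap K ℂ (p.2 (b p.1))) ∘ₗ
        (Ψ : ℂ ⊗[K] (K ⊗[F₀] V) →ₗ[ℂ] (J × (K ≃ₐ[F₀] K) → ℂ)) := by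
    refine (e.baseChange ℂ).ext fun p => ?_
    obtain ⟨j, x⟩ := p
    rw [LinearMap.comp_apply, LinearMap.comp_apply, LinearEquiv.coe_coe,
      Module.Basis.baseChange_apply, LinearMap.baseChange_tmul, LinearMap.baseChange_eq_ltensor, he,
      TensorProduct.tmul_smul, ← algebraMap_smul ℂ (x (b j)), LinearEquiv.map_smul, hΨe, torusOn_coordVecOn]
  exact LinearMap.congr_fun hext z

end Model

/-! ### §3 The dictionary on wedges -/

section Wedge

variable [FiniteDimensional F₀ K] [Algebra K ℂ] [DecidableEq J] [DecidableEq (K ≃ₐ[F₀] K)]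

omit [Fintype J] [Module K V] [IsScalarTower F₀ K V] [FiniteDimensional F₀ K] in
/-- **Wedges of unit multiples of coordinate vectors**: if `Ψ (1 ⊗ e p) = u p • e_p`, then
`⋀ⁿ Ψ ((1 ⊗ e (s 1)) ∧ ⋯ ∧ (1 ⊗ e (s n))) = (∏ i, u (s i)) • e_s` — the coordinate wedge of `s`, up to the unit
`∏ u`. -/
theorem map_ιMulti_tmul_eq_prod_smul_coordWedgeOn (n : ℕ)
    (Ψ : ℂ ⊗[K] (K ⊗[F₀] V) ≃ₗ[ℂ] (J × (K ≃ₐ[F₀] K) → ℂ))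
    (e : J × (K ≃ₐ[F₀] K) → K ⊗[F₀] V) (u : J × (K ≃ₐ[F₀] K) → ℂ)
    (hu : ∀ p, Ψ ((1 : ℂ) ⊗ₜ[K] e p) = u p • coordVecOn p) (s : Fin n → J × (K ≃ₐ[F₀] K)) :
    exteriorPower.map n (Ψ : ℂ ⊗[K] (K ⊗[F₀] V) →ₗ[ℂ] (J × (K ≃ₐ[F₀] K) → ℂ))
        (exteriorPower.ιMulti ℂ n (fun i => (1 : ℂ) ⊗ₜ[K] e (s i))) =
      (∏ i, u (s i)) • coordWedgeOn n s := by
  rw [exteriorPower.map_apply_ιMulti]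
  have h : ((Ψ : ℂ ⊗[K] (K ⊗[F₀] V) →ₗ[ℂ] (J × (K ≃ₐ[F₀] K) → ℂ)) ∘ fun i => (1 : ℂ) ⊗ₜ[K] e (s i)) =
      fun i => u (s i) • coordVecOn (s i) := by
    funext i
    simp only [Function.comp_apply, LinearEquiv.coe_coe, hu]
  rw [h, coordWedgeOn]
  exact AlternatingMap.map_smul_univ (exteriorPower.ιMulti ℂ n) (fun i => u (s i)) (fun i => coordVecOn (s i))

omit [Module K V] [IsScalarTower F₀ K V] in
/-- **The dictionary on `H^n = ⋀ⁿ H¹`, coefficient by coefficient.**  Through the base change `K → ℂ` of the wedge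
space (`Φ₂`, the `(K, ℂ)`-instance of `Tier3WedgeBaseChange`) and the identification `Ψ` of `H¹`, the class `1 ⊗ z`
of `z = Σ_s c_s E_s ∈ K ⊗[F₀] ⋀ⁿ V` becomes `Σ_s (c_s · ∏_{p ∈ s} u_p) • e_s` on the coordinate wedges `e_s` of the
model: the coefficients transfer up to the units `∏ u`. -/
theorem map_baseChange_tmul_eq_sum_smul_coordWedgeOn (n : ℕ) [LinearOrder (J × (K ≃ₐ[F₀] K))]
    (Φ : K ⊗[F₀] ⋀[F₀]^n V ≃ₗ[K] ⋀[K]^n (K ⊗[F₀] V))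
    (e : Module.Basis (J × (K ≃ₐ[F₀] K)) K (K ⊗[F₀] V))
    (E : Module.Basis (Set.powersetCard (J × (K ≃ₐ[F₀] K)) n) K (K ⊗[F₀] ⋀[F₀]^n V))
    (hE : ∀ s, Φ (E s) = exteriorPower.ιMulti_family K n e s)
    (Φ₂ : ℂ ⊗[K] ⋀[K]^n (K ⊗[F₀] V) ≃ₗ[ℂ] ⋀[ℂ]^n (ℂ ⊗[K] (K ⊗[F₀] V)))
    (hΦ₂ : ∀ (c : ℂ) (v : Fin n → K ⊗[F₀] V),
      Φ₂ (c ⊗ₜ[K] exteriorPower.ιMulti K n v) = c • exteriorPower.ιMulti ℂ n (fun i => (1 : ℂ) ⊗ₜ[K] v i))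
    (Ψ : ℂ ⊗[K] (K ⊗[F₀] V) ≃ₗ[ℂ] (J × (K ≃ₐ[F₀] K) → ℂ))
    (u : J × (K ≃ₐ[F₀] K) → ℂ) (hu : ∀ p, Ψ ((1 : ℂ) ⊗ₜ[K] e p) = u p • coordVecOn p)
    (z : K ⊗[F₀] ⋀[F₀]^n V) :
    exteriorPower.map n (Ψ : ℂ ⊗[K] (K ⊗[F₀] V) →ₗ[ℂ] (J × (K ≃ₐ[F₀] K) → ℂ))
        (Φ₂ (LinearMap.baseChange ℂ (Φ : K ⊗[F₀] ⋀[F₀]^n V →ₗ[K] ⋀[K]^n (K ⊗[F₀] V)) ((1 : ℂ) ⊗ₜ[K] z))) =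
      ∑ s, (algebraMap K ℂ (E.repr z s) * ∏ i, u (Set.powersetCard.ofFinEmbEquiv.symm s i)) •
        coordWedgeOn n (Set.powersetCard.ofFinEmbEquiv.symm s) := by
  conv_lhs => rw [← E.sum_repr z]
  rw [TensorProduct.tmul_sum, map_sum, map_sum, map_sum]
  refine Finset.sum_congr rfl fun s _ => ?_
  rw [TensorProduct.tmul_smul, ← algebraMap_smul ℂ (E.repr z s), LinearMap.map_smul, LinearEquiv.map_smul,
    LinearMap.map_smul, LinearMap.baseChange_tmul, LinearEquiv.coe_coe, hE, exteriorPower.ιMulti_family, hΦ₂,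
    one_smul]
  have h := map_ιMulti_tmul_eq_prod_smul_coordWedgeOn n Ψ e u hu (Set.powersetCard.ofFinEmbEquiv.symm s)
  simp only [Function.comp_apply] at h ⊢
  rw [h, smul_smul]

end Wedge

end HodgeRepro.Tier3
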